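import Literature.Geometry.Lorentzian.BogovskiiKernelBaseDeriv
import Literature.Analysis.SingularIntegrals.SmoothlyTruncatedKernelCZ
import HarnessLib

/-!
# The frozen, smoothly truncated second-derivative operator of `S_η`: smoothness in the base point, `L²` bound

(trunk G08 = T-LORENTZ; family `gr`; namespace `Literature.Geometry.Lorentzian.MaoOhTao`.)

Mao–Oh–Tao (arXiv:2308.13031), Lemma 2.3 (S3).  For the frozen Calderón–Zygmund kernel `K₂[η](t; w)`
(`BogovskiiKernelCZ`) and the smooth truncation `θ_ε = radialCutoff ε (2ε)`, the **frozen truncated operator**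

  `T_ε[η](w, x) = ∫ (1 − θ_ε(t)) K₂[η](t; w) g(x − t) dt`   (`g` continuous with compact support)

is studied as a function of the base point `w` and the output point `x` separately — the device by which the
variable-coefficient singular integral `x ↦ T_ε[η](x, x)` is controlled through frozen convolution operators
(`Literature.Analysis.Calculus.exists_diag_lintegral_sq_le`):

* `hasFDerivAt_frozenOp`, `fderiv_frozenOp_e`: `T_ε[η](·, x)` is differentiable with
  `∂_{w_a} T_ε[η](w, x) = T_ε[∂_aη](w, x)` (derivative under the integral, `hasFDerivAt_integral_kernel_mul_shift`,
  and `∂_{y_a}K₂[η] = K₂[∂_aη]`);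
* `contDiff_frozenOp`: `T_ε[η](·, x) ∈ Cⁿ` for `η ∈ C^{n+4}` (induction on `n`);
* `measurable_frozenOp_uncurry`: joint measurability in `(w, x)`;
* `exists_frozenOp_l2Const`: **uniform `L²` bound** `∫ |T_ε[η](w, x)|² dx ≤ C ∫ |g|²` for all `ε > 0` and `|w| ≤ W`,
  from `Literature.Analysis.SingularIntegrals.eLpNorm_truncate_convolution_le` (Grafakos, Thm. 5.4.1) with the size,
  gradient and primitive bounds of `BogovskiiKernelCZ` / `BogovskiiKernelBaseDeriv`.

## References

* Y. Mao, S.-J. Oh, T. Tao, arXiv:2308.13031 (2023), Lemma 2.3, pp. 8–9 (key `MaoOhTao2023`).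
* L. Grafakos, *Classical Fourier Analysis*, 3rd ed., Thm. 5.4.1.
-/

noncomputable section

open scoped RealInnerProductSpace Topology Convolution ENNReal
open Filter MeasureTheory Set Metric Function
open Literature.Analysis.FluidPDE

namespace Literature.Geometry.Lorentzian

namespace MaoOhTao

section ParametricConvolution

/-! ### A parameter-dependent kernel against a continuous compactly supported density: derivative in the parameter -/

variable {k : E3 → E3 → ℝ} {k' : E3 → E3 → (E3 →L[ℝ] ℝ)} {g : E3 → ℝ}

/-- `t ↦ g(x − t)` has compact support if `g` has. [folklore] -/
theorem hasCompactSupport_comp_sub_left (hgc : HasCompactSupport g) (x : E3) : HasCompactSupport fun t : E3 ↦ g (x - t) :=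
  hgc.comp_homeomorph (Homeomorph.subLeft x)

/-- Integrability of `t ↦ k(w, t) g(x − t)` for `k(w, ·)` continuous and `g` continuous with compact support. [folklore] -/
theorem integrable_kernel_mul_shift {w : E3} (hk : Continuous (k w)) (hg : Continuous g) (hgc : HasCompactSupport g)
    (x : E3) : Integrable fun t ↦ k w t * g (x - t) :=
  (hk.mul (hg.comp (continuous_const.sub continuous_id))).integrable_of_hasCompactSupport
    (hasCompactSupport_comp_sub_left hgc x).mul_left

/-- **Differentiation in the parameter under the integral**: if `k(·, t)` has derivative `k'(w, t)` everywhere, with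
`k(w, ·)`, `k'(w, ·)` continuous and `‖k'(w, t)‖ ≤ B` for `w` near `w₀`, then for continuous compactly supported `g`
`w ↦ ∫ k(w, t) g(x − t) dt` has derivative `∫ g(x − t) k'(w₀, t) dt` at `w₀`. [folklore] -/
theorem hasFDerivAt_integral_kernel_mul_shift (hk : ∀ w, Continuous (k w)) (hk' : ∀ w, Continuous (k' w))
    (hd : ∀ w t, HasFDerivAt (k · t) (k' w t) w) {w₀ : E3} {B : ℝ} (hb : ∀ w ∈ ball w₀ 1, ∀ t, ‖k' w t‖ ≤ B)
    (hg : Continuous g) (hgc : HasCompactSupport g) (x : E3) :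
    HasFDerivAt (fun w ↦ ∫ t, k w t * g (x - t)) (∫ t, g (x - t) • k' w₀ t) w₀ := by
  have hB : 0 ≤ B := (norm_nonneg _).trans (hb w₀ (mem_ball_self one_pos) 0)
  set F : E3 → E3 → ℝ := fun w t ↦ k w t * g (x - t) with hF
  set F' : E3 → E3 → (E3 →L[ℝ] ℝ) := fun w t ↦ g (x - t) • k' w t with hF'
  have hgs : Continuous fun t : E3 ↦ g (x - t) := hg.comp (continuous_const.sub continuous_id)
  have hF_meas : ∀ᶠ w in 𝓝 w₀, AEStronglyMeasurable (F w) volume :=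
    Eventually.of_forall fun w ↦ ((hk w).mul hgs).aestronglyMeasurable
  have hF_int : Integrable (F w₀) := integrable_kernel_mul_shift (hk w₀) hg hgc x
  have hF'_meas : AEStronglyMeasurable (F' w₀) volume := (hgs.smul (hk' w₀)).aestronglyMeasurable
  have h_bound : ∀ᵐ t ∂(volume : Measure E3), ∀ w ∈ ball w₀ 1, ‖F' w t‖ ≤ B * |g (x - t)| := by
    refine ae_of_all _ fun t w hw ↦ ?_
    rw [hF', norm_smul, Real.norm_eq_abs, mul_comm]
    gcongr
    exact hb w hw t
  have hbi : Integrable fun t : E3 ↦ B * |g (x - t)| :=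
    ((hgs.abs.integrable_of_hasCompactSupport (hasCompactSupport_comp_sub_left hgc x).abs).const_mul B)
  have h_diff : ∀ᵐ t ∂(volume : Measure E3), ∀ w ∈ ball w₀ 1, HasFDerivAt (F · t) (F' w t) w :=
    ae_of_all _ fun t w _ ↦ (hd w t).mul_const (g (x - t))
  exact hasFDerivAt_integral_of_dominated_of_fderiv_le (ball_mem_nhds w₀ one_pos) hF_meas hF_int hF'_meas h_bound
    hbi h_diff

/-- The directional derivatives: `∂_{w,v} ∫ k(w, t) g(x − t) dt = ∫ (k'(w, t) v) g(x − t) dt`. [folklore] -/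
theorem fderiv_integral_kernel_mul_shift_apply (hk : ∀ w, Continuous (k w)) (hk' : ∀ w, Continuous (k' w))
    (hd : ∀ w t, HasFDerivAt (k · t) (k' w t) w) {w₀ : E3} {B : ℝ} (hb : ∀ w ∈ ball w₀ 1, ∀ t, ‖k' w t‖ ≤ B)
    (hg : Continuous g) (hgc : HasCompactSupport g) (x v : E3) :
    fderiv ℝ (fun w ↦ ∫ t, k w t * g (x - t)) w₀ v = ∫ t, k' w₀ t v * g (x - t) := by
  rw [(hasFDerivAt_integral_kernel_mul_shift hk hk' hd hb hg hgc x).fderiv]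
  have hgs : Continuous fun t : E3 ↦ g (x - t) := hg.comp (continuous_const.sub continuous_id)
  have hint : Integrable (fun t ↦ g (x - t) • k' w₀ t) :=
    (hgs.smul (hk' w₀)).integrable_of_hasCompactSupport (hasCompactSupport_comp_sub_left hgc x).smul_right
  rw [ContinuousLinearMap.integral_apply hint v]
  refine integral_congr_ae (ae_of_all _ fun t ↦ ?_)
  simp only [FunLike.coe_smul, Pi.smul_apply, smul_eq_mul]
  ring

end ParametricConvolution


section Bounds

variable {φ : E3 → ℝ} {R : ℝ}

/-- A compactly supported `C³` function and its partials up to order three are bounded by one constant. [folklore] -/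
theorem exists_bound_pd_le_three (hφ : ContDiff ℝ 3 φ) (hR : ∀ z : E3, R < ‖z‖ → φ z = 0) :
    ∃ M : ℝ, (∀ w, |φ w| ≤ M) ∧ (∀ a w, |pd a φ w| ≤ M) ∧ (∀ a b w, |pd a (pd b φ) w| ≤ M) ∧
      ∀ a b c w, |pd a (pd b (pd c φ)) w| ≤ M := by
  -- every `ψ` continuous and vanishing off `B̄_R` is bounded
  have key : ∀ ψ : E3 → ℝ, Continuous ψ → (∀ z : E3, R < ‖z‖ → ψ z = 0) → ∃ C, ∀ w, |ψ w| ≤ C := by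
    intro ψ hψ hψR
    obtain ⟨C, hC⟩ := hψ.bounded_above_of_compact_support (HasCompactSupport.intro (isCompact_closedBall (0 : E3) R)
      fun z hz ↦ hψR z (by rwa [mem_closedBall, dist_zero_right, not_le] at hz))
    exact ⟨C, fun w ↦ (Real.norm_eq_abs _).symm.le.trans (hC w)⟩
  have h0 := key φ hφ.continuous hR
  have h1 : ∀ a, ∃ C, ∀ w, |pd a φ w| ≤ C := fun a ↦ by
    obtain ⟨h, hv⟩ := contDiff_pd_and_vanish (n := 2) hφ hR a
    exact key _ h.continuous hv
  have h2 : ∀ a b, ∃ C, ∀ w, |pd a (pd b φ) w| ≤ C := fun a b ↦ by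
    obtain ⟨hb, hvb⟩ := contDiff_pd_and_vanish (n := 2) hφ hR b
    obtain ⟨h, hv⟩ := contDiff_pd_and_vanish (n := 1) hb hvb a
    exact key _ h.continuous hv
  have h3 : ∀ a b c, ∃ C, ∀ w, |pd a (pd b (pd c φ)) w| ≤ C := fun a b c ↦ by
    obtain ⟨hc, hvc⟩ := contDiff_pd_and_vanish (n := 2) hφ hR c
    obtain ⟨hb, hvb⟩ := contDiff_pd_and_vanish (n := 1) hc hvc b
    obtain ⟨h, hv⟩ := contDiff_pd_and_vanish (n := 0) hb hvb a
    exact key _ h.continuous hv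
  choose C1 hC1 using h1
  choose C2 hC2 using h2
  choose C3 hC3 using h3
  obtain ⟨C0, hC0⟩ := h0
  refine ⟨max (max C0 (Finset.univ.sup' Finset.univ_nonempty C1))
    (max (Finset.univ.sup' Finset.univ_nonempty fun p : Fin 3 × Fin 3 ↦ C2 p.1 p.2)
      (Finset.univ.sup' Finset.univ_nonempty fun p : Fin 3 × Fin 3 × Fin 3 ↦ C3 p.1 p.2.1 p.2.2)), ?_, ?_, ?_, ?_⟩
  · intro w; exact (hC0 w).trans (le_max_of_le_left (le_max_left _ _))
  · intro a w
    refine (hC1 a w).trans (le_max_of_le_left (le_max_of_le_right ?_))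
    exact Finset.le_sup' C1 (Finset.mem_univ a)
  · intro a b w
    refine (hC2 a b w).trans (le_max_of_le_right (le_max_of_le_left ?_))
    exact Finset.le_sup' (fun p : Fin 3 × Fin 3 ↦ C2 p.1 p.2) (Finset.mem_univ (a, b))
  · intro a b c w
    refine (hC3 a b c w).trans (le_max_of_le_right (le_max_of_le_right ?_))
    exact Finset.le_sup' (fun p : Fin 3 × Fin 3 × Fin 3 ↦ C3 p.1 p.2.1 p.2.2) (Finset.mem_univ (a, b, c))

end Bounds

section FrozenKernel

variable {φ : E3 → ℝ} {R ε : ℝ} {i j k l : Fin 3}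

/-- **The smoothly truncated frozen kernel is continuous** in `t` (for `φ ∈ C³`). [folklore] -/
theorem continuous_truncK2 (hφ : ContDiff ℝ 3 φ) (hR : ∀ z : E3, R < ‖z‖ → φ z = 0) (hε : 0 < ε) (i j k l : Fin 3)
    (w : E3) : Continuous fun t : E3 ↦ (1 - radialCutoff ε (2 * ε) t) * bogovskiiK2 φ w i j k l t :=
  Literature.Analysis.SingularIntegrals.continuous_mul_of_eqOn_ball_zero
    (continuous_const.sub (radialCutoff_contDiff (n := 0) ε (2 * ε)).continuous) hε
    (fun t ht ↦ by rw [radialCutoff_eq_one hε.le (by linarith) ht.le, sub_self])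
    (continuousOn_bogovskiiK2 hφ hR w i j k l)

/-- The truncated frozen kernel vanishes on `|t| ≤ ε`. [folklore] -/
theorem truncK2_eq_zero_of_le (φ : E3 → ℝ) (hε : 0 < ε) (i j k l : Fin 3) (w : E3) {t : E3} (ht : ‖t‖ ≤ ε) :
    (1 - radialCutoff ε (2 * ε) t) * bogovskiiK2 φ w i j k l t = 0 := by
  rw [radialCutoff_eq_one hε.le (by linarith) ht, sub_self, zero_mul]

/-- **Base-point derivative of the truncated frozen kernel**: for every `t`,
`D_w[(1 − θ_ε(t)) K₂[φ](t; w)] = Σ_a (1 − θ_ε(t)) K₂[∂_aφ](t; w) · proj_a` (`φ ∈ C³`). [cite: MaoOhTao2023, Lemma 2.3] -/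
theorem hasFDerivAt_truncK2_base (hφ : ContDiff ℝ 3 φ) (hR : ∀ z : E3, R < ‖z‖ → φ z = 0) (hε : 0 < ε)
    (i j k l : Fin 3) (t w : E3) :
    HasFDerivAt (fun w ↦ (1 - radialCutoff ε (2 * ε) t) * bogovskiiK2 φ w i j k l t)
      (∑ a, ((1 - radialCutoff ε (2 * ε) t) * bogovskiiK2 (pd a φ) w i j k l t) •
        (EuclideanSpace.proj a : E3 →L[ℝ] ℝ)) w := by
  by_cases ht : ‖t‖ ≤ ε
  · have h0 : (1 : ℝ) - radialCutoff ε (2 * ε) t = 0 := by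
      rw [radialCutoff_eq_one hε.le (by linarith) ht, sub_self]
    simp only [h0, zero_mul, zero_smul, Finset.sum_const_zero]
    exact hasFDerivAt_const 0 w
  · have ht0 : t ≠ 0 := by
      intro h; rw [h, norm_zero] at ht; exact ht hε.le
    obtain ⟨hd, hdir⟩ := hasFDerivAt_bogovskiiK2_base hφ hR i j k l ht0 w
    have h1 : HasFDerivAt (fun w ↦ bogovskiiK2 φ w i j k l t)
        (∑ a, bogovskiiK2 (pd a φ) w i j k l t • (EuclideanSpace.proj a : E3 →L[ℝ] ℝ)) w := by
      have := hd.hasFDerivAt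
      rw [fderiv_eq_sum_pd] at this
      simp only [pd] at this hdir
      simpa only [hdir] using this
    have h2 := h1.const_mul (1 - radialCutoff ε (2 * ε) t)
    rw [Finset.smul_sum] at h2
    simpa only [smul_smul, smul_eq_mul] using h2

/-- Size of the truncated frozen kernels with `η` replaced by a first partial, uniformly on `|w| ≤ ρ`:
`|(1 − θ_ε) K₂[∂_aφ](t; w)| ≤ M(4D³ + 8D⁴ + 2D⁵) ε⁻³`. [folklore] -/
theorem abs_truncK2_pd_le (hφ : ContDiff ℝ 3 φ) (hR : ∀ z : E3, R < ‖z‖ → φ z = 0) {M : ℝ}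
    (hM1 : ∀ a w, |pd a φ w| ≤ M) (hM2 : ∀ a b w, |pd a (pd b φ) w| ≤ M) (hM3 : ∀ a b c w, |pd a (pd b (pd c φ)) w| ≤ M)
    (hε : 0 < ε) {ρ : ℝ} {w : E3} (hw : ‖w‖ ≤ ρ) (i j k l a : Fin 3) (t : E3) :
    |(1 - radialCutoff ε (2 * ε) t) * bogovskiiK2 (pd a φ) w i j k l t| ≤
      M * (4 * (max (R + ρ) 0) ^ 3 + 8 * (max (R + ρ) 0) ^ 4 + 2 * (max (R + ρ) 0) ^ 5) / ε ^ 3 := by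
  have hMnn : 0 ≤ M := (abs_nonneg _).trans (hM1 0 0)
  have hD0 : 0 ≤ max (R + ρ) 0 := le_max_right _ _
  by_cases ht : ‖t‖ ≤ ε
  · rw [truncK2_eq_zero_of_le _ hε i j k l w ht, abs_zero]; positivity
  · have htε : ε < ‖t‖ := not_le.1 ht
    have ht0 : t ≠ 0 := norm_pos_iff.1 (hε.trans htε)
    obtain ⟨haφ, hRa⟩ := contDiff_pd_and_vanish (n := 2) hφ hR a
    rw [abs_mul]
    calc _ ≤ 1 * (M * (4 * (max (R + ρ) 0) ^ 3 + 8 * (max (R + ρ) 0) ^ 4 + 2 * (max (R + ρ) 0) ^ 5) / ‖t‖ ^ 3) :=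
          mul_le_mul (Literature.Analysis.SingularIntegrals.abs_one_sub_radialCutoff_le ε t)
            (abs_bogovskiiK2_le haφ hRa (hM1 a) (fun b w ↦ hM2 b a w) (fun b c w ↦ hM3 b c a w) hw i j k l ht0)
            (abs_nonneg _) zero_le_one
      _ ≤ _ := by
          rw [one_mul]
          gcongr

/-- Norm of the base-point derivative of the truncated frozen kernel, uniformly on `|w| ≤ ρ`:
`‖D_w[(1 − θ_ε)K₂[φ]](t; w)‖ ≤ 3M(4D³ + 8D⁴ + 2D⁵) ε⁻³`. [folklore] -/
theorem norm_truncK2_base_deriv_le (hφ : ContDiff ℝ 3 φ) (hR : ∀ z : E3, R < ‖z‖ → φ z = 0) {M : ℝ}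
    (hM1 : ∀ a w, |pd a φ w| ≤ M) (hM2 : ∀ a b w, |pd a (pd b φ) w| ≤ M) (hM3 : ∀ a b c w, |pd a (pd b (pd c φ)) w| ≤ M)
    (hε : 0 < ε) {ρ : ℝ} {w : E3} (hw : ‖w‖ ≤ ρ) (i j k l : Fin 3) (t : E3) :
    ‖∑ a, ((1 - radialCutoff ε (2 * ε) t) * bogovskiiK2 (pd a φ) w i j k l t) • (EuclideanSpace.proj a : E3 →L[ℝ] ℝ)‖ ≤
      3 * (M * (4 * (max (R + ρ) 0) ^ 3 + 8 * (max (R + ρ) 0) ^ 4 + 2 * (max (R + ρ) 0) ^ 5) / ε ^ 3) := by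
  calc _ ≤ ∑ a, ‖((1 - radialCutoff ε (2 * ε) t) * bogovskiiK2 (pd a φ) w i j k l t) •
        (EuclideanSpace.proj a : E3 →L[ℝ] ℝ)‖ := norm_sum_le _ _
    _ ≤ ∑ _a : Fin 3, M * (4 * (max (R + ρ) 0) ^ 3 + 8 * (max (R + ρ) 0) ^ 4 + 2 * (max (R + ρ) 0) ^ 5) / ε ^ 3 := by
        refine Finset.sum_le_sum fun a _ ↦ ?_
        rw [norm_smul, Real.norm_eq_abs]
        calc _ ≤ |(1 - radialCutoff ε (2 * ε) t) * bogovskiiK2 (pd a φ) w i j k l t| * 1 := by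
              gcongr
              refine ContinuousLinearMap.opNorm_le_bound _ zero_le_one fun v ↦ ?_
              rw [one_mul]
              simpa using PiLp.norm_apply_le v a
          _ ≤ _ := by rw [mul_one]; exact abs_truncK2_pd_le hφ hR hM1 hM2 hM3 hε hw i j k l a t
    _ = _ := by simp [Finset.sum_const, Finset.card_univ, Fintype.card_fin]

end FrozenKernel

section FrozenOperator

variable {φ : E3 → ℝ} {R ε : ℝ} {g : E3 → ℝ}

/-- **The frozen truncated operator is differentiable in the base point, derivative under the integral**: for
`φ ∈ C⁴` vanishing off `B̄_R`, `ε > 0` and `g` continuous with compact support,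
`D_w ∫ (1 − θ_ε(t)) K₂[φ](t; w) g(x − t) dt = ∫ g(x − t) D_w[(1 − θ_ε(t)) K₂[φ](t; w)] dt`.
[cite: MaoOhTao2023, Lemma 2.3 (S3)] -/
theorem hasFDerivAt_frozenOp (hφ : ContDiff ℝ 4 φ) (hR : ∀ z : E3, R < ‖z‖ → φ z = 0) (hε : 0 < ε)
    (hg : Continuous g) (hgc : HasCompactSupport g) (i j k l : Fin 3) (x w₀ : E3) :
    HasFDerivAt (fun w ↦ ∫ t, (1 - radialCutoff ε (2 * ε) t) * bogovskiiK2 φ w i j k l t * g (x - t))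
      (∫ t, g (x - t) • ∑ a, ((1 - radialCutoff ε (2 * ε) t) * bogovskiiK2 (pd a φ) w₀ i j k l t) •
        (EuclideanSpace.proj a : E3 →L[ℝ] ℝ)) w₀ := by
  have h3 : ContDiff ℝ 3 φ := hφ.of_le (by norm_cast)
  obtain ⟨M, -, hM1, hM2, hM3⟩ := exists_bound_pd_le_three h3 hR
  have hk : ∀ w, Continuous fun t : E3 ↦ (1 - radialCutoff ε (2 * ε) t) * bogovskiiK2 φ w i j k l t :=
    fun w ↦ continuous_truncK2 h3 hR hε i j k l w
  have hk' : ∀ w, Continuous fun t : E3 ↦ ∑ a, ((1 - radialCutoff ε (2 * ε) t) * bogovskiiK2 (pd a φ) w i j k l t) •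
      (EuclideanSpace.proj a : E3 →L[ℝ] ℝ) := by
    intro w
    refine continuous_finsetSum _ fun a _ ↦ ?_
    obtain ⟨haφ, hRa⟩ := contDiff_pd_and_vanish (n := 3) hφ hR a
    exact (continuous_truncK2 haφ hRa hε i j k l w).smul continuous_const
  exact hasFDerivAt_integral_kernel_mul_shift hk hk' (fun w t ↦ hasFDerivAt_truncK2_base h3 hR hε i j k l t w)
    (B := 3 * (M * (4 * (max (R + (‖w₀‖ + 1)) 0) ^ 3 + 8 * (max (R + (‖w₀‖ + 1)) 0) ^ 4 +
      2 * (max (R + (‖w₀‖ + 1)) 0) ^ 5) / ε ^ 3))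
    (fun w hw t ↦ norm_truncK2_base_deriv_le h3 hR hM1 hM2 hM3 hε (ρ := ‖w₀‖ + 1)
      (by rw [mem_ball, dist_eq_norm] at hw; have := norm_sub_norm_le w w₀; linarith) i j k l t) hg hgc x

/-- **Directional base-point derivatives fall on `η`**:
`∂_{w_a} ∫ (1 − θ_ε) K₂[φ](t; w) g(x − t) dt = ∫ (1 − θ_ε) K₂[∂_aφ](t; w) g(x − t) dt`. [cite: MaoOhTao2023, Lemma 2.3 (S3)] -/
theorem fderiv_frozenOp_e (hφ : ContDiff ℝ 4 φ) (hR : ∀ z : E3, R < ‖z‖ → φ z = 0) (hε : 0 < ε)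
    (hg : Continuous g) (hgc : HasCompactSupport g) (i j k l : Fin 3) (x w : E3) (a : Fin 3) :
    fderiv ℝ (fun w ↦ ∫ t, (1 - radialCutoff ε (2 * ε) t) * bogovskiiK2 φ w i j k l t * g (x - t)) w (e a) =
      ∫ t, (1 - radialCutoff ε (2 * ε) t) * bogovskiiK2 (pd a φ) w i j k l t * g (x - t) := by
  have h3 : ContDiff ℝ 3 φ := hφ.of_le (by norm_cast)
  obtain ⟨M, -, hM1, hM2, hM3⟩ := exists_bound_pd_le_three h3 hR
  have hk : ∀ w, Continuous fun t : E3 ↦ (1 - radialCutoff ε (2 * ε) t) * bogovskiiK2 φ w i j k l t :=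
    fun w ↦ continuous_truncK2 h3 hR hε i j k l w
  have hk' : ∀ w, Continuous fun t : E3 ↦ ∑ a, ((1 - radialCutoff ε (2 * ε) t) * bogovskiiK2 (pd a φ) w i j k l t) •
      (EuclideanSpace.proj a : E3 →L[ℝ] ℝ) := by
    intro w
    refine continuous_finsetSum _ fun a _ ↦ ?_
    obtain ⟨haφ, hRa⟩ := contDiff_pd_and_vanish (n := 3) hφ hR a
    exact (continuous_truncK2 haφ hRa hε i j k l w).smul continuous_const
  rw [fderiv_integral_kernel_mul_shift_apply hk hk' (fun w t ↦ hasFDerivAt_truncK2_base h3 hR hε i j k l t w)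
    (B := 3 * (M * (4 * (max (R + (‖w‖ + 1)) 0) ^ 3 + 8 * (max (R + (‖w‖ + 1)) 0) ^ 4 +
      2 * (max (R + (‖w‖ + 1)) 0) ^ 5) / ε ^ 3))
    (fun w' hw t ↦ norm_truncK2_base_deriv_le h3 hR hM1 hM2 hM3 hε (ρ := ‖w‖ + 1)
      (by rw [mem_ball, dist_eq_norm] at hw; have := norm_sub_norm_le w' w; linarith) i j k l t) hg hgc x (e a)]
  refine integral_congr_ae (ae_of_all _ fun t ↦ ?_)
  simp only [FunLike.coe_sum, Finset.sum_apply, FunLike.coe_smul, Pi.smul_apply,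
    smul_eq_mul]
  simp [e, Finset.sum_ite_eq']

end FrozenOperator

section FrozenOperatorSmooth

variable {R ε : ℝ} {g : E3 → ℝ}

/-- **The frozen truncated operator is `Cⁿ` in the base point** when `η ∈ C^{n+4}`: by induction on `n`, the
derivative being the operator of the same type with `η` replaced by `∂_aη`. [cite: MaoOhTao2023, Lemma 2.3 (S3)] -/
theorem contDiff_frozenOp (hε : 0 < ε) (hg : Continuous g) (hgc : HasCompactSupport g) (i j k l : Fin 3) :
    ∀ (n : ℕ) (φ : E3 → ℝ), ContDiff ℝ ((n + 4 : ℕ) : WithTop ℕ∞) φ → (∀ z : E3, R < ‖z‖ → φ z = 0) → ∀ x : E3,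
      ContDiff ℝ n fun w ↦ ∫ t, (1 - radialCutoff ε (2 * ε) t) * bogovskiiK2 φ w i j k l t * g (x - t)
  | 0, φ, hφ, hR, x => by
    have h4 : ContDiff ℝ 4 φ := hφ.of_le (by norm_cast)
    exact contDiff_zero.2 (continuous_iff_continuousAt.2 fun w ↦
      (hasFDerivAt_frozenOp h4 hR hε hg hgc i j k l x w).continuousAt)
  | n + 1, φ, hφ, hR, x => by
    have h4 : ContDiff ℝ 4 φ := hφ.of_le (by norm_cast; omega)
    have hφ' : ContDiff ℝ (((n + 4 : ℕ) : WithTop ℕ∞) + 1) φ := by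
      have : (((n + 4 : ℕ) : WithTop ℕ∞) + 1) = ((n + 1 + 4 : ℕ) : WithTop ℕ∞) := by push_cast; ring
      rw [this]; exact hφ
    have hsucc : ((n + 1 : ℕ) : WithTop ℕ∞) = (n : WithTop ℕ∞) + 1 := by push_cast; rfl
    rw [hsucc, contDiff_succ_iff_hasFDerivAt]
    refine ⟨fun w ↦ ∑ a, (∫ t, (1 - radialCutoff ε (2 * ε) t) * bogovskiiK2 (pd a φ) w i j k l t * g (x - t)) •
      (EuclideanSpace.proj a : E3 →L[ℝ] ℝ), ?_, fun w ↦ ?_⟩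
    · refine ContDiff.sum fun a _ ↦ ?_
      have ha : ContDiff ℝ ((n + 4 : ℕ) : WithTop ℕ∞) (pd a φ) := contDiff_pd hφ' a
      have hRa : ∀ z : E3, R < ‖z‖ → pd a φ z = 0 := fun z hz ↦ pd_eq_zero_of_norm_lt hR a z hz
      exact (contDiff_frozenOp hε hg hgc i j k l n (pd a φ) ha hRa x).smul contDiff_const
    · have hd := (hasFDerivAt_frozenOp h4 hR hε hg hgc i j k l x w).differentiableAt.hasFDerivAt
      have heq : fderiv ℝ (fun w ↦ ∫ t, (1 - radialCutoff ε (2 * ε) t) * bogovskiiK2 φ w i j k l t * g (x - t)) w =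
          ∑ a, (∫ t, (1 - radialCutoff ε (2 * ε) t) * bogovskiiK2 (pd a φ) w i j k l t * g (x - t)) •
            (EuclideanSpace.proj a : E3 →L[ℝ] ℝ) := by
        rw [fderiv_eq_sum_pd]
        refine Finset.sum_congr rfl fun a _ ↦ ?_
        rw [pd, fderiv_frozenOp_e h4 hR hε hg hgc i j k l x w a]
      rwa [heq] at hd

/-- Differentiability of the frozen truncated operator in the base point. [folklore] -/
theorem differentiable_frozenOp {φ : E3 → ℝ} (hφ : ContDiff ℝ 4 φ) (hR : ∀ z : E3, R < ‖z‖ → φ z = 0) (hε : 0 < ε)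
    (hg : Continuous g) (hgc : HasCompactSupport g) (i j k l : Fin 3) (x : E3) :
    Differentiable ℝ fun w ↦ ∫ t, (1 - radialCutoff ε (2 * ε) t) * bogovskiiK2 φ w i j k l t * g (x - t) :=
  fun w ↦ (hasFDerivAt_frozenOp hφ hR hε hg hgc i j k l x w).differentiableAt

/-- **Joint measurability** of the frozen truncated operator in `(w, x)`. [folklore] -/
theorem measurable_frozenOp_uncurry {φ : E3 → ℝ} (hφ : ContDiff ℝ 2 φ) (ε : ℝ) (hg : Continuous g) (i j k l : Fin 3) :
    Measurable fun p : E3 × E3 ↦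
      ∫ t, (1 - radialCutoff ε (2 * ε) t) * bogovskiiK2 φ p.1 i j k l t * g (p.2 - t) := by
  have hθ : Measurable fun t : E3 ↦ 1 - radialCutoff ε (2 * ε) t :=
    (continuous_const.sub (radialCutoff_contDiff (n := 0) ε (2 * ε)).continuous).measurable
  have hK := measurable_bogovskiiK2_uncurry hφ i j k l
  have m1 : Measurable fun q : (E3 × E3) × E3 ↦ 1 - radialCutoff ε (2 * ε) q.2 := hθ.comp measurable_snd
  have mi : Measurable fun q : (E3 × E3) × E3 ↦ (q.2, q.1.1) :=
    measurable_snd.prodMk (measurable_fst.comp measurable_fst)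
  -- `(e :)`: elaborate without the expected type (higher-order unification against the `bogovskiiK2` lambda
  -- otherwise unfolds the kernel and times out)
  have m2 : Measurable fun q : (E3 × E3) × E3 ↦ bogovskiiK2 φ q.1.1 i j k l q.2 := (hK.comp mi :)
  have m3 : Measurable fun q : (E3 × E3) × E3 ↦ g (q.1.2 - q.2) :=
    hg.measurable.comp ((measurable_snd.comp measurable_fst).sub measurable_snd)
  have hF : Measurable fun q : (E3 × E3) × E3 ↦
      (1 - radialCutoff ε (2 * ε) q.2) * bogovskiiK2 φ q.1.1 i j k l q.2 * g (q.1.2 - q.2) := (m1.mul m2).mul m3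
  have hS : StronglyMeasurable (uncurry fun (p : E3 × E3) (t : E3) ↦
      (1 - radialCutoff ε (2 * ε) t) * bogovskiiK2 φ p.1 i j k l t * g (p.2 - t)) := (hF.stronglyMeasurable :)
  exact ((hS.integral_prod_right (ν := (volume : Measure E3))).measurable :)

end FrozenOperatorSmooth

section FrozenOperatorL2

variable {φ : E3 → ℝ} {R : ℝ}

/-- The real kernel integral as a complex convolution: `((1_S K) ⋆ g_ℂ)(x) = ↑(∫ K(t) g(x − t) dt)` when `K` vanishes
off `S`. [folklore] -/
theorem convolution_indicator_ofReal_eq {K g : E3 → ℝ} {S : Set E3} (hS : ∀ t, t ∉ S → K t = 0) (x : E3) :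
    (S.indicator K ⋆[ContinuousLinearMap.lsmul ℝ ℝ, volume] fun y ↦ (g y : ℂ)) x = ((∫ t, K t * g (x - t) : ℝ) : ℂ) := by
  rw [convolution_def, show ((∫ t, K t * g (x - t) : ℝ) : ℂ) = ∫ t, ((K t * g (x - t) : ℝ) : ℂ) from
    (integral_ofReal (𝕜 := ℂ)).symm]
  refine integral_congr_ae (ae_of_all _ fun t ↦ ?_)
  have hK : S.indicator K t = K t := by
    by_cases ht : t ∈ S
    · rw [indicator_of_mem ht]
    · rw [indicator_of_notMem ht, hS t ht]
  show (ContinuousLinearMap.lsmul ℝ ℝ (S.indicator K t)) ((g (x - t) : ℝ) : ℂ) = ((K t * g (x - t) : ℝ) : ℂ)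
  rw [ContinuousLinearMap.lsmul_apply, hK, Complex.real_smul, Complex.ofReal_mul]

/-- `∫⁻ ‖f‖ₑ² = ‖f‖₂²`. [folklore] -/
theorem lintegral_enorm_sq_eq_eLpNorm_sq {α F : Type*} [MeasurableSpace α] {μ : Measure α} [NormedAddCommGroup F]
    (f : α → F) : ∫⁻ x, ‖f x‖ₑ ^ (2 : ℝ) ∂μ = eLpNorm f 2 μ ^ (2 : ℝ) := by
  have h := eLpNorm_nnreal_pow_eq_lintegral (f := f) (μ := μ) (p := (2 : NNReal)) two_ne_zero
  simp only [NNReal.coe_ofNat, ENNReal.coe_ofNat] at h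
  exact h.symm

/-- **Uniform `L²` bound for the frozen truncated operators** (Calderón–Zygmund, via
`eLpNorm_truncate_convolution_le`): for `φ ∈ C⁴` vanishing off `B̄_R` and `W ≥ 0` there is `C < ∞` with
`∫ |∫ (1 − θ_ε(t)) K₂[φ](t; w) g(x − t) dt|² dx ≤ C ∫ |g|²` for all `ε > 0`, all base points `|w| ≤ W` and all continuous
compactly supported `g`. [cite: MaoOhTao2023, Lemma 2.3 (S3)] -/
theorem exists_frozenOp_l2Const (hφ : ContDiff ℝ 4 φ) (hR : ∀ z : E3, R < ‖z‖ → φ z = 0) (i j k l : Fin 3) (W : ℝ) :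
    ∃ C : ℝ≥0∞, C < ⊤ ∧ ∀ ε : ℝ, 0 < ε → ∀ w : E3, ‖w‖ ≤ W → ∀ g : E3 → ℝ, Continuous g → HasCompactSupport g →
      ∫⁻ x, ‖∫ t, (1 - radialCutoff ε (2 * ε) t) * bogovskiiK2 φ w i j k l t * g (x - t)‖ₑ ^ (2 : ℝ) ≤
        C * ∫⁻ x, ‖g x‖ₑ ^ (2 : ℝ) := by
  have h1 : ContDiff ℝ 1 φ := hφ.of_le (by norm_cast)
  have h2 : ContDiff ℝ 2 φ := hφ.of_le (by norm_cast)
  have h3 : ContDiff ℝ 3 φ := hφ.of_le (by norm_cast)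
  obtain ⟨M, hM0, hM1, hM2, hM3⟩ := exists_bound_pd_le_three h3 hR
  have hMnn : 0 ≤ M := (abs_nonneg _).trans (hM0 0)
  obtain ⟨B, hB0, hB⟩ := exists_norm_fderiv_radialCutoff_le
  obtain ⟨Cs, hC0, hC⟩ := Literature.Analysis.SingularIntegrals.exists_norm_deriv_smoothTransition_le
  set D : ℝ := max (R + W) 0 with hD
  have hD0 : 0 ≤ D := le_max_right _ _
  set A₀ : ℝ := M * (4 * D ^ 3 + 8 * D ^ 4 + 2 * D ^ 5) with hA₀
  set A₁ : ℝ := 3 * (M * (12 * D ^ 4 + 12 * D ^ 5 + 2 * D ^ 6)) with hA₁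
  set A : ℝ := A₀ + A₁ with hA
  set A' : ℝ := M * (4 * D ^ 3 + 2 * D ^ 4) with hA'
  have hA₀0 : 0 ≤ A₀ := by positivity
  have hA₁0 : 0 ≤ A₁ := by positivity
  set V : ℝ := (volume : Measure E3).real (ball 0 1) with hV
  set Atot : ℝ := 15 * (8 * A * V + 24 * A * (1 + 2 * B) * V + ‖e l‖ * (A' * V * (38 * Cs + 7 * B))) with hAtot
  refine ⟨ENNReal.ofReal Atot ^ (2 : ℝ), ENNReal.rpow_lt_top_of_nonneg (by norm_num) ENNReal.ofReal_ne_top, ?_⟩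
  intro ε hε w hw g hg hgc
  have hρ : ‖w‖ ≤ W := hw
  -- the hypotheses of the Calderón–Zygmund bound for `K = K₂[φ](·; w)`
  have hK : ContDiffOn ℝ 1 (bogovskiiK2 φ w i j k l) {0}ᶜ := contDiffOn_bogovskiiK2 hφ hR w i j k l
  have hK0 : ∀ z : E3, z ≠ 0 → |bogovskiiK2 φ w i j k l z| ≤ A * (‖z‖ ^ 3)⁻¹ := by
    intro z hz
    have hn : 0 < ‖z‖ := norm_pos_iff.2 hz
    calc _ ≤ A₀ / ‖z‖ ^ 3 := abs_bogovskiiK2_le h2 hR hM0 hM1 hM2 hρ i j k l hz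
      _ ≤ A / ‖z‖ ^ 3 := by gcongr; linarith
      _ = A * (‖z‖ ^ 3)⁻¹ := div_eq_mul_inv _ _
  have hK1 : ∀ z : E3, z ≠ 0 → ‖fderiv ℝ (bogovskiiK2 φ w i j k l) z‖ ≤ A * (‖z‖ ^ 4)⁻¹ := by
    intro z hz
    have hn : 0 < ‖z‖ := norm_pos_iff.2 hz
    calc _ ≤ 3 * (M * (12 * D ^ 4 + 12 * D ^ 5 + 2 * D ^ 6) / ‖z‖ ^ 4) :=
          norm_fderiv_bogovskiiK2_le h3 hR hM1 hM2 hM3 hρ i j k l hz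
      _ = A₁ / ‖z‖ ^ 4 := by rw [hA₁]; ring
      _ ≤ A / ‖z‖ ^ 4 := by gcongr; linarith
      _ = A * (‖z‖ ^ 4)⁻¹ := div_eq_mul_inv _ _
  have hG : ∀ z : E3, z ≠ 0 → DifferentiableAt ℝ (pd k (fun z : E3 ↦ z i * z j * bogovskiiQ φ w 2 z)) z :=
    fun z hz ↦ differentiableAt_pd_classicalKernel h2 hR w i j k hz
  have hKG : ∀ z : E3, z ≠ 0 → bogovskiiK2 φ w i j k l z =
      fderiv ℝ (pd k (fun z : E3 ↦ z i * z j * bogovskiiQ φ w 2 z)) z (e l) :=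
    fun z hz ↦ (fderiv_pd_classicalKernel_apply_e h2 hR w i j k l hz).symm
  have hG2 : ∀ z : E3, z ≠ 0 → |pd k (fun z : E3 ↦ z i * z j * bogovskiiQ φ w 2 z) z| ≤ A' * (‖z‖ ^ 2)⁻¹ := by
    intro z hz
    rw [← div_eq_mul_inv]
    exact abs_pd_classicalKernel_le h1 hR hM0 hM1 hρ i j k hz
  -- the complex density
  have hgC : Continuous fun y ↦ (g y : ℂ) := Complex.continuous_ofReal.comp hg
  have hgCc : HasCompactSupport fun y ↦ (g y : ℂ) := hgc.comp_left Complex.ofReal_zero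
  have hf : Integrable fun y ↦ (g y : ℂ) := hgC.integrable_of_hasCompactSupport hgCc
  have hf2 : MemLp (fun y ↦ (g y : ℂ)) 2 volume := hgC.memLp_of_hasCompactSupport hgCc
  have hε' : (0 : ℝ) < ε / 2 := by positivity
  have hN : ε / 2 < D + ε + 1 := by linarith
  have hL2 := Literature.Analysis.SingularIntegrals.eLpNorm_truncate_convolution_le hK hK0 hK1 hG hKG hG2 hB0 hB
    hC0 hC hε hε' hN hf hf2
  -- the truncated kernel lives in the shell `ε/2 < |t| < D + ε + 1`
  have hvan : ∀ t, t ∉ ball (0 : E3) (D + ε + 1) \ closedBall 0 (ε / 2) →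
      (1 - radialCutoff ε (2 * ε) t) * bogovskiiK2 φ w i j k l t = 0 := by
    intro t ht
    rw [Set.mem_sdiff, not_and_or, not_not, mem_ball, dist_zero_right, not_lt, mem_closedBall, dist_zero_right] at ht
    rcases ht with ht | ht
    · have : max (R + ‖w‖) 0 < ‖t‖ := by
        calc max (R + ‖w‖) 0 ≤ D := max_le_max (by linarith) le_rfl
          _ < ‖t‖ := by linarith
      rw [bogovskiiK2_eq_zero_of_lt hR w i j k l this, mul_zero]
    · exact Literature.Analysis.SingularIntegrals.truncate_eq_zero _ hε (by linarith)
  have hconv : ∀ x, ((ball (0 : E3) (D + ε + 1) \ closedBall 0 (ε / 2)).indicator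
      (fun z : E3 ↦ (1 - radialCutoff ε (2 * ε) z) * bogovskiiK2 φ w i j k l z) ⋆[ContinuousLinearMap.lsmul ℝ ℝ, volume]
        fun y ↦ (g y : ℂ)) x =
      ((∫ t, (1 - radialCutoff ε (2 * ε) t) * bogovskiiK2 φ w i j k l t * g (x - t) : ℝ) : ℂ) :=
    fun x ↦ convolution_indicator_ofReal_eq hvan x
  -- pass to squared `L²` norms
  have hlhs : ∫⁻ x, ‖∫ t, (1 - radialCutoff ε (2 * ε) t) * bogovskiiK2 φ w i j k l t * g (x - t)‖ₑ ^ (2 : ℝ) =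
      eLpNorm (((ball (0 : E3) (D + ε + 1) \ closedBall 0 (ε / 2)).indicator
        (fun z : E3 ↦ (1 - radialCutoff ε (2 * ε) z) * bogovskiiK2 φ w i j k l z) ⋆[ContinuousLinearMap.lsmul ℝ ℝ, volume]
        fun y ↦ (g y : ℂ))) 2 volume ^ (2 : ℝ) := by
    rw [← lintegral_enorm_sq_eq_eLpNorm_sq]
    refine lintegral_congr fun x ↦ ?_
    rw [hconv x, enorm_eq_nnnorm, enorm_eq_nnnorm, Complex.nnnorm_real]
  have hrhs : ∫⁻ x, ‖g x‖ₑ ^ (2 : ℝ) = eLpNorm (fun y ↦ (g y : ℂ)) 2 volume ^ (2 : ℝ) := by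
    rw [← lintegral_enorm_sq_eq_eLpNorm_sq]
    refine lintegral_congr fun x ↦ ?_
    rw [enorm_eq_nnnorm, enorm_eq_nnnorm, Complex.nnnorm_real]
  rw [hlhs, hrhs, ← ENNReal.mul_rpow_of_nonneg _ _ (by norm_num)]
  exact ENNReal.rpow_le_rpow hL2 (by norm_num)

end FrozenOperatorL2

end MaoOhTao

end Literature.Geometry.Lorentzian
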